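import Literature.NumberTheory.Automorphic.ArithmeticQuotientCohomology
import Summits.Langlands.Langlands.Theorems.ParityBlindBianchiTwoAdicBianchiProModularityLevelOddIndexLevelChange
import Summits.Langlands.Langlands.Theorems.ParityBlindBianchiTwoAdicBianchiProModularityLevelLimitClosure
import Mathlib.RepresentationTheory.Homological.GroupCohomology.LongExactSequence
import HarnessLib

/-!
# `TwoAdicBianchiProModularityLevel` (crux stmt-Langlands-15110, route `ParityBlindBianchi`) —
# SUPPORT DÉVISSAGE: Hecke supports over a prime ideal split along exact sequences

For a `k`-module `H` with operators `S : J → End_k H`, values `χ : J → k` and an ideal `𝔭 ≤ k`,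
**`χ mod 𝔭` is supported on `H`** when every non-commutative polynomial `P ∈ FreeAlgebra k J` in the
`S_j` that vanishes on `H` has `P(χ) ∈ 𝔭` (`T_j ↦ χ j` extends to a `k`-algebra map
`k⟨S_j⟩ → k/𝔭`; for `𝔭 = 𝔪` and Hecke operators: "`𝔪_χ ∈ Supp_𝕋(H)`", the hypothesis shape of big
`R = 𝕋` statements, [CalegariGeraghty2017, §1], [GeeNewton2020, §5.1]).  Written out in full in every
statement (no definition; same style as `isHeckePoint_iff_forall_freeAlgebra`).  For `𝔭` PRIME:
§1 support passes along equivariant embeddings / surjections (`supp_of_injective`,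
`supp_of_surjective`), splits along an equivariant `A → B → C` exact at `B` (`supp_or_supp_of_exact`:
if `P` kills `A` and `Q` kills `C` then `P·Q` kills `B` — no commutativity needed), on finitely many
pieces sits on one of them (`exists_supp_of_supp_finset`), is a congruence invariant of `χ`
(`supp_congr`) and needs `H ≠ 0` (`nontrivial_of_supp`); §2 for `0 → X₁ → X₂ → X₃ → 0` short exact in
`Rep k G` with compatible endomorphisms, Mathlib's long exact sequence (`mapShortComplex₁/₂/₃_exact`,
`δ_naturality`) gives `Supp Hⁿ(X₂) ⊆ Supp Hⁿ(X₁) ∪ Supp Hⁿ(X₃)`, `Supp Hʲ(X₁) ⊆ Supp Hʲ(X₂) ∪ Supp Hʲ⁻¹(X₃)`,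
`Supp Hⁱ(X₃) ⊆ Supp Hⁱ(X₂) ∪ Supp Hⁱ⁺¹(X₁)`; §3 a short exact sequence of coefficient modules gives a
short exact Hecke-equivariant sequence of coefficient representations `Fun(𝒢/L, M_•)`
(`coeff_shortExact`), whence the three inclusions for the Hecke supports of `H^•(X_L, M_•)`
(`supp_coeff_X₁_or_X₃`, `…_X₂_or_X₃`, `…_X₂_or_X₁`; registered sub-goal `coeff_supp_devissage`) — the
Bockstein mechanism by which `…ResidualSupport` reads the occurrence hypothesis of stub B as
"`𝔪_σ̄` in the support of ONE `H^i(X_{U₀K(2^s)}, 𝔽)`".  Sorry-free, definition-free; lead c10.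

## References

* K. S. Brown, *Cohomology of Groups*, GTM 87 (1982), III §6 Prop. 6.1 [Brown1982CohomologyGroups].
* F. Calegari, D. Geraghty, Invent. Math. 211 (2018), §1 [CalegariGeraghty2017]; T. Gee, J. Newton,
  JIMJ 21 (2022), §5.1 [GeeNewton2020].
-/

noncomputable section

set_option linter.dupNamespace false

namespace Summit.Langlands.Langlands.Theorems.TwoAdicBianchiProModularityLevel

open CategoryTheory Literature.NumberTheory.Automorphic

universe v

/-! ### §1 Support calculus over a prime ideal -/

section Supp

variable {k : Type} [CommRing k] {J : Type v}
  {A : Type} [AddCommGroup A] [Module k A]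
  {B : Type} [AddCommGroup B] [Module k B]
  {C : Type} [AddCommGroup C] [Module k C]
  {χ : J → k} {𝔭 : Ideal k}

/-- **Support passes along equivariant embeddings**: if `χ mod 𝔭` is supported on `A` and `A`
embeds into `B` compatibly with the operators, it is supported on `B` (a relation among the
operators on `B` restricts to `A`). [folklore] -/
theorem supp_of_injective (SA : J → Module.End k A) (SB : J → Module.End k B) (f : A →ₗ[k] B)
    (hf : ∀ j, f ∘ₗ SA j = SB j ∘ₗ f) (hinj : Function.Injective f)
    (h : ∀ P : FreeAlgebra k J, FreeAlgebra.lift k SA P = 0 → FreeAlgebra.lift k χ P ∈ 𝔭) :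
    ∀ P : FreeAlgebra k J, FreeAlgebra.lift k SB P = 0 → FreeAlgebra.lift k χ P ∈ 𝔭 := by
  intro P hP
  refine h P (LinearMap.ext fun a => hinj ?_)
  have hc := LinearMap.congr_fun (comp_lift_eq_lift_comp SA SB f hf P) a
  rw [LinearMap.comp_apply, LinearMap.comp_apply, hP, LinearMap.zero_apply] at hc
  rw [hc, LinearMap.zero_apply, map_zero]

/-- **Support passes along equivariant surjections (to the source)**: if `χ mod 𝔭` is supported on a
quotient `B` of `A` (compatibly with the operators), it is supported on `A`. [folklore] -/
theorem supp_of_surjective (SA : J → Module.End k A) (SB : J → Module.End k B) (f : A →ₗ[k] B)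
    (hf : ∀ j, f ∘ₗ SA j = SB j ∘ₗ f) (hsurj : Function.Surjective f)
    (h : ∀ P : FreeAlgebra k J, FreeAlgebra.lift k SB P = 0 → FreeAlgebra.lift k χ P ∈ 𝔭) :
    ∀ P : FreeAlgebra k J, FreeAlgebra.lift k SA P = 0 → FreeAlgebra.lift k χ P ∈ 𝔭 := by
  intro P hP
  refine h P (LinearMap.ext fun b => ?_)
  obtain ⟨a, rfl⟩ := hsurj b
  have hc := LinearMap.congr_fun (comp_lift_eq_lift_comp SA SB f hf P) a
  rw [LinearMap.comp_apply, LinearMap.comp_apply, hP, LinearMap.zero_apply, map_zero] at hc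
  rw [← hc, LinearMap.zero_apply]

/-- **Support splits along exact sequences.**  Let `A → B → C` be `k`-linear maps, equivariant for
operator families `S_A, S_B, S_C`, with `ker(B → C) ⊆ im(A → B)`, and let `𝔭` be prime.  If
`χ mod 𝔭` is supported on `B` then it is supported on `A` or on `C`: otherwise some `P` kills `A` with
`P(χ) ∉ 𝔭` and some `Q` kills `C` with `Q(χ) ∉ 𝔭`; then `Q(S_B)` maps `B` into `ker = im`, which
`P(S_B)` kills, so `(P·Q)(S_B) = 0` while `(P·Q)(χ) = P(χ)Q(χ) ∉ 𝔭`.  (The operator algebras need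
not be commutative.) [folklore] -/
theorem supp_or_supp_of_exact (SA : J → Module.End k A) (SB : J → Module.End k B)
    (SC : J → Module.End k C) (f : A →ₗ[k] B) (g : B →ₗ[k] C)
    (hf : ∀ j, f ∘ₗ SA j = SB j ∘ₗ f) (hg : ∀ j, g ∘ₗ SB j = SC j ∘ₗ g)
    (hex : ∀ b, g b = 0 → ∃ a, f a = b) (h𝔭 : 𝔭.IsPrime)
    (h : ∀ P : FreeAlgebra k J, FreeAlgebra.lift k SB P = 0 → FreeAlgebra.lift k χ P ∈ 𝔭) :
    (∀ P : FreeAlgebra k J, FreeAlgebra.lift k SA P = 0 → FreeAlgebra.lift k χ P ∈ 𝔭) ∨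
      ∀ P : FreeAlgebra k J, FreeAlgebra.lift k SC P = 0 → FreeAlgebra.lift k χ P ∈ 𝔭 := by
  by_contra hcon
  rw [not_or] at hcon
  obtain ⟨hA, hC⟩ := hcon
  push Not at hA hC
  obtain ⟨P, hP0, hP⟩ := hA
  obtain ⟨Q, hQ0, hQ⟩ := hC
  have hPQ : FreeAlgebra.lift k SB (P * Q) = 0 := by
    refine LinearMap.ext fun b => ?_
    rw [map_mul, Module.End.mul_apply, LinearMap.zero_apply]
    have hgb : g (FreeAlgebra.lift k SB Q b) = 0 := by
      have hc := LinearMap.congr_fun (comp_lift_eq_lift_comp SB SC g hg Q) b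
      rw [LinearMap.comp_apply, LinearMap.comp_apply, hQ0, LinearMap.zero_apply] at hc
      exact hc
    obtain ⟨a, ha⟩ := hex _ hgb
    rw [← ha]
    have hc := LinearMap.congr_fun (comp_lift_eq_lift_comp SA SB f hf P) a
    rw [LinearMap.comp_apply, LinearMap.comp_apply, hP0, LinearMap.zero_apply, map_zero] at hc
    exact hc.symm
  have hmem := h _ hPQ
  rw [map_mul] at hmem
  exact (h𝔭.mem_or_mem hmem).elim hP hQ

/-- **Support is a congruence invariant of the values**: if `χ ≡ χ'` modulo `𝔭` value by value,
`χ mod 𝔭` and `χ' mod 𝔭` are supported on the same modules. [folklore] -/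
theorem supp_congr (S : J → Module.End k A) {χ' : J → k} (hχ : ∀ j, χ j - χ' j ∈ 𝔭)
    (h : ∀ P : FreeAlgebra k J, FreeAlgebra.lift k S P = 0 → FreeAlgebra.lift k χ P ∈ 𝔭) :
    ∀ P : FreeAlgebra k J, FreeAlgebra.lift k S P = 0 → FreeAlgebra.lift k χ' P ∈ 𝔭 := by
  intro P hP
  have h3 : FreeAlgebra.lift k χ' P =
      FreeAlgebra.lift k χ P - (FreeAlgebra.lift k χ P - FreeAlgebra.lift k χ' P) := by ring
  exact h3 ▸ 𝔭.sub_mem (h P hP) (freeAlgebra_lift_sub_lift_mem 𝔭 hχ P)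

/-- **Support needs a non-zero module**: if `χ mod 𝔭` is supported on `A` for a proper ideal `𝔭`,
then `A ≠ 0` (on the zero module the empty product `1` vanishes). [folklore] -/
theorem nontrivial_of_supp (S : J → Module.End k A) (h𝔭 : 𝔭 ≠ ⊤)
    (h : ∀ P : FreeAlgebra k J, FreeAlgebra.lift k S P = 0 → FreeAlgebra.lift k χ P ∈ 𝔭) :
    Nontrivial A := by
  by_contra hA
  rw [not_nontrivial_iff_subsingleton] at hA
  apply h𝔭
  rw [Ideal.eq_top_iff_one]
  have h1 := h 1 (LinearMap.ext fun a => Subsingleton.elim _ _)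
  rwa [map_one] at h1

/-- **Support on finitely many pieces forces support on one piece** (`𝔭` prime): if every `P`
vanishing on each of the modules `H_w`, `w ∈ I` (`I` finite), has `P(χ) ∈ 𝔭`, then for some
`w ∈ I` every `P` vanishing on `H_w` alone has `P(χ) ∈ 𝔭`.  (Induction on `I`: if `P` kills `H_w`
with `P(χ) ∉ 𝔭` and `Q` kills the other pieces, `P·Q` kills all of them; `I = ∅` is excluded by
`P = 1`.) [folklore] -/
theorem exists_supp_of_supp_finset {ιI : Type*} {H : ιI → Type} [∀ w, AddCommGroup (H w)]
    [∀ w, Module k (H w)] (S : ∀ w, J → Module.End k (H w)) (h𝔭 : 𝔭.IsPrime) (I : Finset ιI)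
    (h : ∀ P : FreeAlgebra k J, (∀ w ∈ I, FreeAlgebra.lift k (S w) P = 0) →
      FreeAlgebra.lift k χ P ∈ 𝔭) :
    ∃ w ∈ I, ∀ P : FreeAlgebra k J, FreeAlgebra.lift k (S w) P = 0 → FreeAlgebra.lift k χ P ∈ 𝔭 := by
  classical
  induction I using Finset.induction_on with
  | empty =>
    exfalso
    have h1 := h 1 (fun w hw => absurd hw (Finset.notMem_empty w))
    exact h𝔭.ne_top ((Ideal.eq_top_iff_one _).mpr (by rwa [map_one] at h1))
  | insert w I _ ih =>
    by_cases hwS : ∀ P : FreeAlgebra k J, FreeAlgebra.lift k (S w) P = 0 → FreeAlgebra.lift k χ P ∈ 𝔭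
    · exact ⟨w, Finset.mem_insert_self w I, hwS⟩
    · have hI : ∀ P : FreeAlgebra k J, (∀ w' ∈ I, FreeAlgebra.lift k (S w') P = 0) →
          FreeAlgebra.lift k χ P ∈ 𝔭 := by
        intro Q hQ
        push Not at hwS
        obtain ⟨P, hP0, hP⟩ := hwS
        have hPQ := h (P * Q) (fun w' hw' => by
          rw [Finset.mem_insert] at hw'
          rw [map_mul]
          rcases hw' with rfl | hw'
          · rw [hP0, zero_mul]
          · rw [hQ w' hw', mul_zero])
        rw [map_mul] at hPQ
        exact (h𝔭.mem_or_mem hPQ).resolve_left hP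
      obtain ⟨w', hw', h'⟩ := ih hI
      exact ⟨w', Finset.mem_insert_of_mem hw', h'⟩

end Supp

/-! ### §2 Dévissage of supports along the long exact sequence of group cohomology -/

section LES

open groupCohomology

variable {k G : Type} [CommRing k] [Group G] {X : ShortComplex (Rep k G)} (hX : X.ShortExact)
  {J : Type v} (F : J → (X ⟶ X)) (χ : J → k) {𝔭 : Ideal k}

omit hX in
/-- Commuting squares of representations give commuting squares in cohomology. [folklore] -/
theorem map_hom_comp_of_comm {A B : Rep k G} (φA : A ⟶ A) (φB : B ⟶ B) (f : A ⟶ B)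
    (h : φA ≫ f = f ≫ φB) (n : ℕ) :
    (map (MonoidHom.id G) f n).hom ∘ₗ (map (MonoidHom.id G) φA n).hom =
      (map (MonoidHom.id G) φB n).hom ∘ₗ (map (MonoidHom.id G) f n).hom := by
  rw [← ModuleCat.hom_comp, ← ModuleCat.hom_comp, ← map_id_comp, ← map_id_comp, h]

include hX in
/-- The connecting homomorphism commutes with compatible endomorphisms (as linear maps). [folklore] -/
theorem δ_hom_comp_map_hom (j₀ : J) {i j : ℕ} (hij : i + 1 = j) :
    (δ hX i j hij).hom ∘ₗ (map (MonoidHom.id G) (F j₀).τ₃ i).hom =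
      (map (MonoidHom.id G) (F j₀).τ₁ j).hom ∘ₗ (δ hX i j hij).hom := by
  rw [← ModuleCat.hom_comp, ← ModuleCat.hom_comp, δ_naturality hX hX (F j₀) i j hij]

include hX in
/-- **`Supp Hⁿ(X₂) ⊆ Supp Hⁿ(X₁) ∪ Supp Hⁿ(X₃)`** for a short exact sequence `0 → X₁ → X₂ → X₃ → 0`
of representations with a compatible family of endomorphisms `F j` (exactness of
`Hⁿ(X₁) → Hⁿ(X₂) → Hⁿ(X₃)`), `𝔭` prime. [cite: Brown1982CohomologyGroups, III §6 Prop. 6.1] -/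
theorem supp_X₁_or_X₃_of_supp_X₂ (h𝔭 : 𝔭.IsPrime) (n : ℕ)
    (h : ∀ P : FreeAlgebra k J,
      FreeAlgebra.lift k (fun j => (map (MonoidHom.id G) (F j).τ₂ n).hom) P = 0 →
        FreeAlgebra.lift k χ P ∈ 𝔭) :
    (∀ P : FreeAlgebra k J,
      FreeAlgebra.lift k (fun j => (map (MonoidHom.id G) (F j).τ₁ n).hom) P = 0 →
        FreeAlgebra.lift k χ P ∈ 𝔭) ∨
    ∀ P : FreeAlgebra k J,
      FreeAlgebra.lift k (fun j => (map (MonoidHom.id G) (F j).τ₃ n).hom) P = 0 →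
        FreeAlgebra.lift k χ P ∈ 𝔭 := by
  have hex := (ShortComplex.moduleCat_exact_iff _).1 (mapShortComplex₂_exact hX n)
  exact supp_or_supp_of_exact _ _ _ (map (MonoidHom.id G) X.f n).hom (map (MonoidHom.id G) X.g n).hom
    (fun j => map_hom_comp_of_comm _ _ _ (F j).comm₁₂ n)
    (fun j => map_hom_comp_of_comm _ _ _ (F j).comm₂₃ n)
    (fun b hb => hex b hb) h𝔭 h

include hX in
/-- **`Supp Hʲ(X₁) ⊆ Supp Hʲ(X₂) ∪ Supp Hʲ⁻¹(X₃)`** (the kernel of `Hʲ(X₁) → Hʲ(X₂)` is the image of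
the connecting map; in degree `0` it is zero), `𝔭` prime. [cite: Brown1982CohomologyGroups, III §6
Prop. 6.1] -/
theorem supp_X₂_or_X₃_of_supp_X₁ (h𝔭 : 𝔭.IsPrime) (j : ℕ)
    (h : ∀ P : FreeAlgebra k J,
      FreeAlgebra.lift k (fun j' => (map (MonoidHom.id G) (F j').τ₁ j).hom) P = 0 →
        FreeAlgebra.lift k χ P ∈ 𝔭) :
    (∀ P : FreeAlgebra k J,
      FreeAlgebra.lift k (fun j' => (map (MonoidHom.id G) (F j').τ₂ j).hom) P = 0 →
        FreeAlgebra.lift k χ P ∈ 𝔭) ∨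
    ∃ i : ℕ, i + 1 = j ∧ ∀ P : FreeAlgebra k J,
      FreeAlgebra.lift k (fun j' => (map (MonoidHom.id G) (F j').τ₃ i).hom) P = 0 →
        FreeAlgebra.lift k χ P ∈ 𝔭 := by
  cases j with
  | zero =>
    left
    haveI := hX.mono_f
    exact supp_of_injective _ _ (map (MonoidHom.id G) X.f 0).hom
      (fun j' => map_hom_comp_of_comm _ _ _ (F j').comm₁₂ 0)
      ((ModuleCat.mono_iff_injective _).1 inferInstance) h
  | succ i =>
    have hex := (ShortComplex.moduleCat_exact_iff _).1 (mapShortComplex₁_exact hX (rfl : i + 1 = i + 1))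
    have hδ := fun j' => δ_hom_comp_map_hom hX F j' (rfl : i + 1 = i + 1)
    exact (supp_or_supp_of_exact (fun j' => (map (MonoidHom.id G) (F j').τ₃ i).hom) _
        (fun j' => (map (MonoidHom.id G) (F j').τ₂ (i + 1)).hom)
        (δ hX i (i + 1) rfl).hom (map (MonoidHom.id G) X.f (i + 1)).hom hδ
        (fun j' => map_hom_comp_of_comm _ _ _ (F j').comm₁₂ _) (fun b hb => hex b hb) h𝔭 h).elim
      (fun h3 => Or.inr ⟨i, rfl, h3⟩) Or.inl

include hX in
/-- **`Supp Hⁱ(X₃) ⊆ Supp Hⁱ(X₂) ∪ Supp Hⁱ⁺¹(X₁)`** (the kernel of the connecting map is the image of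
`Hⁱ(X₂) → Hⁱ(X₃)`), `𝔭` prime. [cite: Brown1982CohomologyGroups, III §6 Prop. 6.1] -/
theorem supp_X₂_or_X₁_of_supp_X₃ (h𝔭 : 𝔭.IsPrime) (i : ℕ)
    (h : ∀ P : FreeAlgebra k J,
      FreeAlgebra.lift k (fun j => (map (MonoidHom.id G) (F j).τ₃ i).hom) P = 0 →
        FreeAlgebra.lift k χ P ∈ 𝔭) :
    (∀ P : FreeAlgebra k J,
      FreeAlgebra.lift k (fun j => (map (MonoidHom.id G) (F j).τ₂ i).hom) P = 0 →
        FreeAlgebra.lift k χ P ∈ 𝔭) ∨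
    ∀ P : FreeAlgebra k J,
      FreeAlgebra.lift k (fun j => (map (MonoidHom.id G) (F j).τ₁ (i + 1)).hom) P = 0 →
        FreeAlgebra.lift k χ P ∈ 𝔭 := by
  have hex := (ShortComplex.moduleCat_exact_iff _).1 (mapShortComplex₃_exact hX (rfl : i + 1 = i + 1))
  have hδ := fun j => δ_hom_comp_map_hom hX F j (rfl : i + 1 = i + 1)
  exact supp_or_supp_of_exact _ _ _ (map (MonoidHom.id G) X.g i).hom (δ hX i (i + 1) rfl).hom
    (fun j => map_hom_comp_of_comm _ _ _ (F j).comm₂₃ i) hδ (fun b hb => hex b hb) h𝔭 h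

end LES

/-! ### §3 Coefficient sequences on arithmetic quotients -/

section Coeff

variable {k : Type} [CommRing k] {Γ 𝒢 : Type} [Group Γ] [Group 𝒢] (ι : Γ →* 𝒢) (L : Subgroup 𝒢)
  {M₁ M₂ M₃ : Type} [AddCommGroup M₁] [Module k M₁] [AddCommGroup M₂] [Module k M₂]
  [AddCommGroup M₃] [Module k M₃] (f : M₁ →ₗ[k] M₂) (g : M₂ →ₗ[k] M₃)
  {J : Type v} (δ : J → 𝒢) (χ : J → k) {𝔭 : Ideal k}

/-- `Fun(𝒢/L, −)` of a complex of coefficient modules is a complex. [folklore] -/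
theorem coeffHom_comp_coeffHom_eq_zero (hfg : ∀ x, g (f x) = 0) :
    ArithmeticQuotient.coeffHom ι L f ≫ ArithmeticQuotient.coeffHom ι L g = 0 := by
  refine Rep.hom_ext (Representation.IntertwiningMap.ext (LinearMap.ext fun h => funext fun c => ?_))
  change g (f (h c)) = 0
  exact hfg (h c)

/-- **`Fun(𝒢/L, −)` is exact**: a short exact sequence `0 → M₁ → M₂ → M₃ → 0` of coefficient modules
gives a short exact sequence of the coefficient representations of level `L` (pointwise). [folklore] -/
theorem coeff_shortExact (hf : Function.Injective f) (hg : Function.Surjective g)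
    (hfg : ∀ x, g (f x) = 0) (hex : ∀ y, g y = 0 → ∃ x, f x = y) :
    (ShortComplex.mk (ArithmeticQuotient.coeffHom ι L f) (ArithmeticQuotient.coeffHom ι L g)
      (coeffHom_comp_coeffHom_eq_zero ι L f g hfg)).ShortExact where
  exact := (forget₂ (Rep k Γ) (ModuleCat k)).reflects_exact_of_faithful _ <|
    (ShortComplex.moduleCat_exact_iff _).2 fun y hy => by
      change (𝒢 ⧸ L) → M₂ at y
      have hy' : ∀ c, g (y c) = 0 := fun c => congr_fun hy c
      choose x hx using fun c => hex (y c) (hy' c)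
      exact ⟨x, funext hx⟩
  mono_f := (Rep.mono_iff_injective _).2 fun h₁ h₂ hh => funext fun c => hf (congr_fun hh c)
  epi_g := (Rep.epi_iff_surjective _).2 fun h =>
    ⟨fun c => (hg (h c)).choose, funext fun c => (hg (h c)).choose_spec⟩

/-- The Hecke operator `T_{δ j}` as a compatible endomorphism of the short exact sequence of
coefficient representations (Hecke operators commute with change of coefficients,
`heckeRepHom_comp_coeffHom`). [folklore] -/
theorem heckeRepHom_comm₁₂ (j : J) :
    ArithmeticQuotient.heckeRepHom k L (δ j) M₁ ι ≫ ArithmeticQuotient.coeffHom ι L f =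
      ArithmeticQuotient.coeffHom ι L f ≫ ArithmeticQuotient.heckeRepHom k L (δ j) M₂ ι :=
  ArithmeticQuotient.heckeRepHom_comp_coeffHom L (δ j) ι f

/-- **`Supp H^i(X_L, M₂) ⊆ Supp H^i(X_L, M₁) ∪ Supp H^i(X_L, M₃)`** for the Hecke operators
`T_{δ j}` and a short exact sequence of coefficient modules `0 → M₁ → M₂ → M₃ → 0`, `𝔭` prime.
[cite: Brown1982CohomologyGroups, III §6 Prop. 6.1] -/
theorem supp_coeff_X₁_or_X₃ (hf : Function.Injective f) (hg : Function.Surjective g)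
    (hfg : ∀ x, g (f x) = 0) (hex : ∀ y, g y = 0 → ∃ x, f x = y) (h𝔭 : 𝔭.IsPrime) (i : ℕ)
    (h : ∀ P : FreeAlgebra k J,
      FreeAlgebra.lift k (fun j => ArithmeticQuotient.heckeEnd k L (δ j) M₂ ι i) P = 0 →
        FreeAlgebra.lift k χ P ∈ 𝔭) :
    (∀ P : FreeAlgebra k J,
      FreeAlgebra.lift k (fun j => ArithmeticQuotient.heckeEnd k L (δ j) M₁ ι i) P = 0 →
        FreeAlgebra.lift k χ P ∈ 𝔭) ∨
    ∀ P : FreeAlgebra k J,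
      FreeAlgebra.lift k (fun j => ArithmeticQuotient.heckeEnd k L (δ j) M₃ ι i) P = 0 →
        FreeAlgebra.lift k χ P ∈ 𝔭 :=
  supp_X₁_or_X₃_of_supp_X₂ (coeff_shortExact ι L f g hf hg hfg hex)
    (fun j => { τ₁ := ArithmeticQuotient.heckeRepHom k L (δ j) M₁ ι
                τ₂ := ArithmeticQuotient.heckeRepHom k L (δ j) M₂ ι
                τ₃ := ArithmeticQuotient.heckeRepHom k L (δ j) M₃ ι
                comm₁₂ := heckeRepHom_comm₁₂ ι L f δ j
                comm₂₃ := heckeRepHom_comm₁₂ ι L g δ j }) χ h𝔭 i h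

/-- **`Supp Hʲ(X_L, M₁) ⊆ Supp Hʲ(X_L, M₂) ∪ Supp Hʲ⁻¹(X_L, M₃)`** (Bockstein direction), `𝔭` prime.
[cite: Brown1982CohomologyGroups, III §6 Prop. 6.1] -/
theorem supp_coeff_X₂_or_X₃ (hf : Function.Injective f) (hg : Function.Surjective g)
    (hfg : ∀ x, g (f x) = 0) (hex : ∀ y, g y = 0 → ∃ x, f x = y) (h𝔭 : 𝔭.IsPrime) (j : ℕ)
    (h : ∀ P : FreeAlgebra k J,
      FreeAlgebra.lift k (fun j' => ArithmeticQuotient.heckeEnd k L (δ j') M₁ ι j) P = 0 →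
        FreeAlgebra.lift k χ P ∈ 𝔭) :
    (∀ P : FreeAlgebra k J,
      FreeAlgebra.lift k (fun j' => ArithmeticQuotient.heckeEnd k L (δ j') M₂ ι j) P = 0 →
        FreeAlgebra.lift k χ P ∈ 𝔭) ∨
    ∃ i : ℕ, i + 1 = j ∧ ∀ P : FreeAlgebra k J,
      FreeAlgebra.lift k (fun j' => ArithmeticQuotient.heckeEnd k L (δ j') M₃ ι i) P = 0 →
        FreeAlgebra.lift k χ P ∈ 𝔭 :=
  supp_X₂_or_X₃_of_supp_X₁ (coeff_shortExact ι L f g hf hg hfg hex)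
    (fun j' => { τ₁ := ArithmeticQuotient.heckeRepHom k L (δ j') M₁ ι
                 τ₂ := ArithmeticQuotient.heckeRepHom k L (δ j') M₂ ι
                 τ₃ := ArithmeticQuotient.heckeRepHom k L (δ j') M₃ ι
                 comm₁₂ := heckeRepHom_comm₁₂ ι L f δ j'
                 comm₂₃ := heckeRepHom_comm₁₂ ι L g δ j' }) χ h𝔭 j h

/-- **`Supp Hⁱ(X_L, M₃) ⊆ Supp Hⁱ(X_L, M₂) ∪ Supp Hⁱ⁺¹(X_L, M₁)`**, `𝔭` prime.
[cite: Brown1982CohomologyGroups, III §6 Prop. 6.1] -/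
theorem supp_coeff_X₂_or_X₁ (hf : Function.Injective f) (hg : Function.Surjective g)
    (hfg : ∀ x, g (f x) = 0) (hex : ∀ y, g y = 0 → ∃ x, f x = y) (h𝔭 : 𝔭.IsPrime) (i : ℕ)
    (h : ∀ P : FreeAlgebra k J,
      FreeAlgebra.lift k (fun j => ArithmeticQuotient.heckeEnd k L (δ j) M₃ ι i) P = 0 →
        FreeAlgebra.lift k χ P ∈ 𝔭) :
    (∀ P : FreeAlgebra k J,
      FreeAlgebra.lift k (fun j => ArithmeticQuotient.heckeEnd k L (δ j) M₂ ι i) P = 0 →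
        FreeAlgebra.lift k χ P ∈ 𝔭) ∨
    ∀ P : FreeAlgebra k J,
      FreeAlgebra.lift k (fun j => ArithmeticQuotient.heckeEnd k L (δ j) M₁ ι (i + 1)) P = 0 →
        FreeAlgebra.lift k χ P ∈ 𝔭 :=
  supp_X₂_or_X₁_of_supp_X₃ (coeff_shortExact ι L f g hf hg hfg hex)
    (fun j => { τ₁ := ArithmeticQuotient.heckeRepHom k L (δ j) M₁ ι
                τ₂ := ArithmeticQuotient.heckeRepHom k L (δ j) M₂ ι
                τ₃ := ArithmeticQuotient.heckeRepHom k L (δ j) M₃ ι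
                comm₁₂ := heckeRepHom_comm₁₂ ι L f δ j
                comm₂₃ := heckeRepHom_comm₁₂ ι L g δ j }) χ h𝔭 i h

/-- **Support dévissage along a short exact sequence of coefficient modules** (registered sub-goal;
the closed form of `supp_coeff_X₁_or_X₃`): for `0 → M₁ → M₂ → M₃ → 0` exact, `𝔭` prime and the Hecke
operators `T_{δ j}` on `H^i(X_L, −)`: `Supp H^i(X_L, M₂) ⊆ Supp H^i(X_L, M₁) ∪ Supp H^i(X_L, M₃)`.
[cite: Brown1982CohomologyGroups, III §6 Prop. 6.1] -/
theorem coeff_supp_devissage : ∀ (k : Type) [CommRing k] (Γ 𝒢 : Type) [Group Γ] [Group 𝒢]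
    (ι : Γ →* 𝒢) (L : Subgroup 𝒢) (M₁ M₂ M₃ : Type) [AddCommGroup M₁] [Module k M₁]
    [AddCommGroup M₂] [Module k M₂] [AddCommGroup M₃] [Module k M₃]
    (f : M₁ →ₗ[k] M₂) (g : M₂ →ₗ[k] M₃) (J : Type) (δ : J → 𝒢) (χ : J → k) (𝔭 : Ideal k),
    Function.Injective f → Function.Surjective g → (∀ x, g (f x) = 0) →
    (∀ y, g y = 0 → ∃ x, f x = y) → 𝔭.IsPrime → ∀ i : ℕ,
    (∀ P : FreeAlgebra k J,
      FreeAlgebra.lift k (fun j => ArithmeticQuotient.heckeEnd k L (δ j) M₂ ι i) P = 0 →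
        FreeAlgebra.lift k χ P ∈ 𝔭) →
    (∀ P : FreeAlgebra k J,
      FreeAlgebra.lift k (fun j => ArithmeticQuotient.heckeEnd k L (δ j) M₁ ι i) P = 0 →
        FreeAlgebra.lift k χ P ∈ 𝔭) ∨
    ∀ P : FreeAlgebra k J,
      FreeAlgebra.lift k (fun j => ArithmeticQuotient.heckeEnd k L (δ j) M₃ ι i) P = 0 →
        FreeAlgebra.lift k χ P ∈ 𝔭 :=
  fun _ _ _ _ _ _ ι L _ _ _ _ _ _ _ _ _ f g _ δ χ _ hf hg hfg hex h𝔭 i h =>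
    supp_coeff_X₁_or_X₃ ι L f g δ χ hf hg hfg hex h𝔭 i h

end Coeff

end Summit.Langlands.Langlands.Theorems.TwoAdicBianchiProModularityLevel

end
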